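import Literature.AlgebraicGeometry.Markman2025.SecantLineChernCharacters

/-!
# Markman 2025 — the secant^{⊠2} object on `X × X̂` (`n = 3`): the displayed expansion in the proof of
# LEMMA 8.3.1 and the «rank 8d» bookkeeping of PROPOSITION 9.2.2, AS PRINTED and kernel-checked

E. Markman: [M] *Cycles on abelian 2n-folds of Weil type from secant sheaves on abelian n-folds*,
arXiv:2502.03415 **v2** (2025-06-08), bib `Markman2025SecantWeil` — UNREFEREED PREPRINT; [S] *Secant sheaves and
Weil classes on abelian varieties*, arXiv:2509.23403 **v2** (2026-02-11), bib `Markman2025SurveySecant` (ICM 2026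
survey; the results it reports remain PREPRINT). «v2 p. N L m» = PyMuPDF line `m` of PDF page `N` of the public arXiv
PDFs (v2 of [M]: sha256/16 `8155aa33870069b8`; v2 of [S]: `3151aee3307548da`), read at seat lit-w-markman
(pub-hsemireg LIT-W, 2026-08-23). This file continues `SecantLineChernCharacters.lean` (same seat), whose `Theta3`
model (the `Θ`-subalgebra `K[Θ]/(Θ⁴)` of `H^{2•}(X, K)` in the divided-power basis `1, Θ, Θ²/2!, Θ³/3! = [pt]`,
with `∫_X` = the `[pt]`-coordinate, `τ` = the sign `(−1)^j` on `H^{2j}`, `exp c = ch(O_X(cΘ))`,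
`α = 1 − (d/2)Θ²`, `β = Θ − d[pt]`) is reused verbatim.

## What is printed (verbatim)

* SETTING, [M] v2 §8.3 p. 56 L16–25: «Keep the notation of Lemma 8.2.1. Set `F₁ := I_{∪_{i=1}^{d+1} C_i} ⊗ O_X(Θ)`. Let
  `P := span{α, β}` be the rational `ℚ(√−d)`-secant plane. Assumption 2.4.1 is satisfied, since
  `(α, β)_S = ∫_X τ(α) ∪ β = ∫_X α ∪ β = −4d ≠ 0`. Let `h` be an ample class in the rank 1 subgroup
  `H²(X × X̂, ℤ)^{Spin(V)_P}`. Such an ample class `h` exists, by Proposition 2.4.4.»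
* LEMMA 8.3.1 ([M] v2 p. 56 L26–27): «The rank of `Φ(F₁ ⊠ F₁)` is non-zero. The `Spin(V)_P`-invariant classes `h³`
  and `κ₃(Φ(F₁ ⊠ F₁))` are linearly independent.»  PROOF, p. 56 L28–74 (the display this file checks): «We use the
  notation of Proposition 6.4.1. We have `ch(Φ(F₁ ⊠ F₁)) = ϕ(ch(F₁) ⊠ ch(F₁)) = ϕ′(ch(F₁) ⊠ τ(ch(F₁)))`. Set
  `λ₁ := exp(√−dΘ)` and `λ₂ = λ̄₁`, so that
  `ch(F₁) = ½[(λ₁ + λ₂) + (1/√−d)(λ₁ − λ₂)] = (1/(2√−d))[(1 + √−d)λ₁ + (−1 + √−d)λ₂]`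
  Now, `τ` interchanges `λ₁` and `λ₂`. Hence,
  `ch(F₁) ⊠ τ(ch(F₁)) = −(1/4d)[(1+√−d)λ₁+(−1+√−d)λ₂] ⊠ [(−1+√−d)λ₁+(1+√−d)λ₂]`
  `= ((d+1)/4d)[λ₁⊠λ₁+λ₂⊠λ₂] + ((d−1)/4d)[λ₁⊠λ₂+λ₂⊠λ₁] + (√−d/2d)[λ₂⊠λ₁−λ₁⊠λ₂]`
  The rank of `Φ(F₁ ⊠ F₁)` is non-zero, by Proposition 6.4.1(2), since the coefficient of `[λ₂⊠λ₁−λ₁⊠λ₂]` is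
  non-zero. We prove that the classes `κ(Φ(F₁ ⊠ F₁))` and `h³` are linearly independent, by contradiction. …
  Hence, `ch(F₁) ⊠ τ(ch(F₁))` is not `Spin(V_K)_{ℓ₁,ℓ₂}`-invariant, since the coefficient of `λ₁⊠λ₁+λ₂⊠λ₂` is non
  zero. A contradiction.»  PROPOSITION 6.4.1 (2) (v2 p. 39 L29–32): «The weights of `ϕ′(ℓ₁ ∧ ℓ₂)` and `ϕ′(ℓ₁ · ℓ₂)`,
  as `Spin(V)_P`-subrepresentations via `ρ′`, are as follows. If `n` is even, then the weight of `ϕ′(ℓ₁ ∧ ℓ₂)` is `2`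
  and the weight of `ϕ′(ℓ₁ · ℓ₂)` is `0`. If `n` is odd, then the weight of `ϕ′(ℓ₁ · ℓ₂)` is `2` and the weight of
  `ϕ′(ℓ₁ ∧ ℓ₂)` is `0`.»  Used at THEOREM 1.4.1 (4) (v2 p. 7 L49–52): «The `η(K)`-translates of the graded summand
  `κ₃(E)` of `κ(E)` in `H^{3,3}(X × X̂, ℚ)`, together with `h³`, span the 3-dimensional subspace `ℚh³ ⊕ ĤW_P`
  (Proposition 6.4.1 and Lemma 8.3.1).»
* (9.2.1) ([M] v2 p. 72 L55–61): «Set `F₁ := I_{∪_{i=1}^{d+1} C_i}(Θ)` and `F₂ := I_{∪_{i=1}^{d+1} Σ_i}(Θ)`. Note that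
  `ch(F₁) = ch(F₂)`.»  PROPOSITION 9.2.2 (v2 p. 73 L13–30): «(1) The sheaf cohomology `R^iπ_{23,*}(π₁^*F₁ ⊗ 𝓕₂)`
  of the object `G := Φ(F₂ ⊠ F₁)[−3] = Rπ_{23,*}(π₁^*F₁ ⊗ 𝓕₂)` (6.2.3) vanishes, for `k = 0` and for `k > 2`. The
  sheaf `G₁ := R¹π_{23,*}(π₁^*F₁ ⊗ 𝓕₂)` over `X × X̂` is reflexive of rank `8d` and it is locally free away from `Θ̃`
  and `Θ̃` is the set theoretic support of the sheaf `G₂ := R²π_{23,*}(π₁^*F₁ ⊗ 𝓕₂)`. (2) The object `G^∨[−1]` is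
  represented by the reflexive coherent sheaf `E` of rank `8d`, which is isomorphic to `G₁^*` and is hence locally
  free away from `Θ̃`. …» (`Θ̃ := ∪_{1≤i,j≤d+1} Θ̃_{i,j}`, p. 73 L4–12; §9 opening, p. 69 L5–7: «`E := G^∨[−1]` is a
  reflexive sheaf over `X × X̂` of rank `8d`, for a generic choice of the curves `C_i` and `Σ_j`. Furthermore, `E`
  is locally free away from `(d+1)²` smooth surfaces in `X × X̂`.»)  PROOF, p. 77 L70–78: «The restriction of `G` to
  the fiber `π₂₃^{−1}((x, L))` is `F₁ ⊗ τ_x^*(F₂) ⊗ L^{−1}`. We will prove part (1) by showing that (i)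
  `H^i(X, F₁ ⊗ τ_x^*(F₂) ⊗ L^{−1})` vanishes for `i ≠ 1` for all `(x, L) ∈ [X × Pic⁰(X)] ∖ Θ̃. (ii) For
  `(x, L) ∈ Θ̃` the cohomology `H^i(X, F₁ ⊗ τ_x^*(F₂) ⊗ L^{−1})` vanishes if and only if `i ∉ {1, 2}`.»; p. 78 L3–5:
  «… where `(K₁)^*` is in degree `0` and `d₁^*` is an injective sheaf homomorphism, whose cokernel `E` has rank
  equal to the rank `8d` of the kernel of `d₁`.»; p. 78 L24–51: «The tensor product `F₁ ⊗ τ_x^*F₂` is isomorphic to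
  `I_{Z_x}(Θ + τ_{−x}(Θ))` for a subscheme `Z_x` of `X` supported on the union of the curves `C_i` and `τ_{−x}(Σ_j)`,
  `1 ≤ i, j ≤ d + 1`, … Set `L′ := L^{−1}(τ_{−x}(Θ) − Θ)`. We have the short exact sequence (9.2.9)
  `0 → F₁ ⊗ τ_x^*(F₂) ⊗ L^{−1} → O_X(2Θ) ⊗ L′ → O_{Z_x}(2Θ) ⊗ L′ → 0`. `H^i(O_X(2Θ) ⊗ L′)` vanishes, for `i > 0`,
  and `H⁰(O_X(2Θ) ⊗ L′)` is 8-dimensional. We have `χ(O_{Z_x}(2Θ) ⊗ L′) = 8(d + 1)`. The later statement is clear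
  when the curves `C_i` and `Σ′_j` are disjoint for all `1 ≤ i, j ≤ d + 1`. In this case `Z_x` is the disjoint union
  of these `2d + 2` curves, `O_{Z_x}(2Θ) ⊗ L′ ≅ [⊕_{i=1}^{d+1} O_{C_i}] ⊕ [⊕_{i=1}^{d+1} O_{Σ′_i}] ⊗ O_X(2Θ) ⊗ L′`,
  The restriction of `O_X(2Θ) ⊗ L′` to each of `C_i` and `Σ′_j` has degree `6` and thus Euler characteristic `4`.
  Hence, `χ(O_Z(2Θ) ⊗ L′) = 8(d + 1)` as claimed.»
* Survey twin, [S] v2 PROPOSITION 11.1 (p. 18 L44–53) «[M2, Lem. 9.1.4, 9.3.1 and Prop. 9.2.2] For a suitable choice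
  of the groups `G₁` and `G₂` and for a generic `C`, the cohomology sheaves `𝒢_i` in degree `i` of the object
  `G := Φ(F₂ ⊠ F₁)[−3]` over `X × X̂` satisfy: (1) `𝒢_i` vanishes for `i ∉ {1, 2}`. (2) `𝒢₁` is a reflexive sheaf
  of rank `8q`, which is locally free away from `Θ̃`. …»; p. 19 L3–7 «The fiber of `𝒢₁`, at a point
  `(x, L) ∈ [X × X̂] ∖ Θ̃`, is naturally isomorphic to `H¹(X, I_{∪C_i} ⊗ I_{∪τ_{−x}(C′_i)}(Θ + τ_{−x}(Θ)) ⊗ L^{−1})`.»;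
  p. 18 L14–15 «The class Poincaré dual to `C_i` is `Θ²/2 ∈ H^{2,2}(X, ℤ)`».

## What this file proves (kernel-checked arithmetic of the sentences above; NO named fact; nothing geometric)
(A) LEMMA 8.3.1's display, for any `s` with `s² = −d`, `d ≠ 0` (so `s` plays `√−d`, `λ₁ = exp(sΘ)`,
`λ₂ = exp(−sΘ)`): `λ₁ = α + sβ`, `λ₂ = α − sβ`; «`τ` interchanges `λ₁` and `λ₂`» (`τ(exp(cΘ)) = exp(−cΘ)`);
`ch(F₁) = α + β = (1/(2s))[(1+s)λ₁ + (−1+s)λ₂]` and `τ(ch F₁) = (1/(2s))[(−1+s)λ₁ + (1+s)λ₂]` IN THE MODEL; the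
prefactor `(1/(2s))² = −1/(4d)`; and — reading `⊠` as the bilinear pairing of coefficient vectors w.r.t. the basis
`{λ_i ⊠ λ_j}` (the `λ_i` are the two DISTINCT pure spinors of Lemma 8.2.1, so `{λ_i ⊠ λ_j}` is a basis of
`P_K ⊗ P_K`; by value) — the displayed expansion with coefficients `(d+1)/4d` on `λ₁⊠λ₁+λ₂⊠λ₂`, `(d−1)/4d` on
`λ₁⊠λ₂+λ₂⊠λ₁`, `s/2d` on `λ₂⊠λ₁−λ₁⊠λ₂`, and the two non-vanishings the proof invokes (`s/2d ≠ 0`; `(d+1)/4d ≠ 0`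
for a positive integer `d`). Proposition 6.4.1 (2) (which graded piece carries the rank) and Lemma 2.2.7 /
Proposition 6.4.1 (1) (the invariance statements) are representation-theoretic inputs BY NAME, not formalised.
(B) PROPOSITION 9.2.2's «rank `8d`» as printed on p. 78: in the model `∫_X exp(2Θ) = (2Θ)³/3! = 8`
(`= χ(O_X(2Θ) ⊗ L′) = h⁰` by HRR with `td(X) = 1` and the printed vanishing of `H^{i>0}`; `L′` algebraically
equivalent to `0` — by value); `deg(O_X(2Θ) ⊗ L′|_{C_i}) = ∫_X 2Θ · (Θ²/2) = 6` ([S] p. 18 L14–15 for `[C_i] = Θ²/2`);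
Riemann–Roch on a genus-3 curve by value: `6 + 1 − 3 = 4`; `(2d+2)·4 = 8(d+1)`; (9.2.9) gives
`χ(F₁ ⊗ τ_x^*F₂ ⊗ L^{−1}) = 8 − 8(d+1) = −8d`, so with (i) (`H^i = 0` for `i ≠ 1` off `Θ̃`) `h¹ = 8d` — the rank of
`G₁ = R¹π_{23,*}` and of `E` (p. 78 L3–5); and the INDEPENDENT cross-check by HRR on `X` (`td(X) = 1`,
`ch(τ_x^*F₂ ⊗ L^{−1}) = ch(F₂) = ch(F₁) = α + β`): `∫_X (α + β)² = −8d` (`∫α² = ∫β² = 0`, `2∫αβ = −8d`), the same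
number; plus `|{(i, j)}| = (d+1)²` for the surfaces `Θ̃_{i,j}`.

## Inputs BY VALUE (printed or standard; NOT proved here) and honest framing
HRR / Riemann–Roch, the vanishing statements (i), `H^{i>0}(O_X(2Θ) ⊗ L′) = 0`, the identification of the fibre of
`G` with `F₁ ⊗ τ_x^*F₂ ⊗ L^{−1}`, `[C_i] = Θ²/2`, base change, reflexivity, and all of Proposition 6.4.1 / Lemma
2.2.7 enter as printed VALUES or by NAME; the kernel adds only ring arithmetic in `K[Θ]/(Θ⁴)`, in `K`, in `ℤ`.
Bookkeeping for the pub-hsemireg LIT-W table rows M-Mk2 (Thm 1.4.1 (4): the `ĤW_P`-coefficient `(d+1)/4d ≠ 0`) and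
M-Mk6 (the one printed `g = 6` object: rank `8d`, the input of `DescentExponentArithmetic.lean`'s
`gcd(8d, d+1)`); it says nothing about semiregularity or the Hodge conjecture and re-proves no theorem of [M]/[S].
-/

namespace Literature.AlgebraicGeometry.Markman2025

/-! ## (A) The display in the proof of Lemma 8.3.1 -/

namespace Theta3

variable {K : Type*} [Field K]

/-- **[M] v2 p. 56 L53** «Now, `τ` interchanges `λ₁` and `λ₂`»: in the model `τ(exp(cΘ)) = exp(−cΘ)` for every `c`
(so `τ(λ₁) = λ₂` and `τ(λ₂) = λ₁` for `λ₁ = exp(√−dΘ)`, `λ₂ = λ̄₁ = exp(−√−dΘ)`).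
[cite: Markman2025SecantWeil, proof of Lemma 8.3.1, v2 p. 56 L53] -/
theorem tau_exp (c : K) : tau (exp c) = exp (-c) := by
  ext <;> simp
  all_goals ring

variable [CharZero K]

/-- **[M] v2 p. 56 L30–32** «Set `λ₁ := exp(√−dΘ)` and `λ₂ = λ̄₁`»: with `s² = −d`, `λ₁ = exp(sΘ) = α + sβ` and the
conjugate `λ₂ = exp(−sΘ) = α − sβ` (both from `SecantLineChernCharacters`' `exp_sqrt_neg`).
[cite: Markman2025SecantWeil, proof of Lemma 8.3.1, v2 p. 56 L30–32] -/
theorem conjugate_pure_spinors (d s : K) (hs : s ^ 2 = -d) :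
    exp s = alpha d + s • beta d ∧ exp (-s) = alpha d - s • beta d := by
  refine ⟨exp_sqrt_neg d s hs, ?_⟩
  have h := exp_sqrt_neg d (-s) (by rw [neg_sq]; exact hs)
  rw [h]; ext <;> simp <;> ring

/-- **[M] v2 p. 56 L33–52, first display** «`ch(F₁) = ½[(λ₁ + λ₂) + (1/√−d)(λ₁ − λ₂)]
= (1/(2√−d))[(1 + √−d)λ₁ + (−1 + √−d)λ₂]`»: with `ch(F₁) = α + β` (Lemma 8.2.1) and `s² = −d ≠ 0`, both
displayed forms equal `α + β` in the model, and applying `τ` (which swaps `λ₁`, `λ₂`) gives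
`τ(ch F₁) = (1/(2s))[(−1 + s)λ₁ + (1 + s)λ₂]` — the second factor of the next display.
[cite: Markman2025SecantWeil, proof of Lemma 8.3.1, v2 p. 56 L33–56] -/
theorem lemma_8_3_1_chF1 (d s : K) (hs : s ^ 2 = -d) (hd : d ≠ 0) :
    alpha d + beta d = (1 / 2 : K) • ((exp s + exp (-s)) + (1 / s) • (exp s - exp (-s))) ∧
    alpha d + beta d = (1 / (2 * s)) • (((1 : K) + s) • exp s + ((-1 : K) + s) • exp (-s)) ∧
    tau (alpha d + beta d) = (1 / (2 * s)) • (((-1 : K) + s) • exp s + ((1 : K) + s) • exp (-s)) := by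
  have hs0 : s ≠ 0 := by
    rintro rfl
    apply hd
    have : (0 : K) ^ 2 = -d := hs
    simpa using this.symm
  have hd' : d = -s ^ 2 := by rw [hs, neg_neg]
  subst hd'
  refine ⟨?_, ?_, ?_⟩
  · ext <;> simp [alpha, beta] <;> field_simp <;> ring
  · ext <;> simp [alpha, beta] <;> field_simp <;> ring
  · ext <;> simp [alpha, beta] <;> field_simp <;> ring

end Theta3

namespace SecantSquared

variable {K : Type*} [Field K] [CharZero K]

/-- **[M] v2 p. 56 L53–72, the displayed expansion in the proof of LEMMA 8.3.1**:
«`ch(F₁) ⊠ τ(ch(F₁)) = −(1/4d)[(1+√−d)λ₁+(−1+√−d)λ₂] ⊠ [(−1+√−d)λ₁+(1+√−d)λ₂]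
= ((d+1)/4d)[λ₁⊠λ₁+λ₂⊠λ₂] + ((d−1)/4d)[λ₁⊠λ₂+λ₂⊠λ₁] + (√−d/2d)[λ₂⊠λ₁−λ₁⊠λ₂]`».  Reading `⊠` as bilinear on
coefficient vectors with respect to `λ₁, λ₂` (the two DISTINCT pure spinors of Lemma 8.2.1, so `{λ_i ⊠ λ_j}` is a
basis of `P_K ⊗ P_K` — by value): for `s² = −d ≠ 0`, first factor `a₁λ₁ + a₂λ₂` with `(a₁, a₂) = (1/2s)(1+s, −1+s)`,
second factor `b₁λ₁ + b₂λ₂` with `(b₁, b₂) = (1/2s)(−1+s, 1+s)`, the prefactor is `(1/2s)² = −1/(4d)` and the four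
coefficients `a_i b_j` of `λ_i ⊠ λ_j` are: `λ₁⊠λ₁ ↦ (d+1)/4d`, `λ₂⊠λ₂ ↦ (d+1)/4d`, `λ₁⊠λ₂ ↦ (d−1)/4d − s/2d`,
`λ₂⊠λ₁ ↦ (d−1)/4d + s/2d` — i.e. exactly `((d+1)/4d)·[λ₁⊠λ₁+λ₂⊠λ₂] + ((d−1)/4d)·[λ₁⊠λ₂+λ₂⊠λ₁] + (s/2d)·[λ₂⊠λ₁−λ₁⊠λ₂]`.
[cite: Markman2025SecantWeil, proof of Lemma 8.3.1, v2 p. 56 L53–72] -/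
theorem lemma_8_3_1_expansion (d s c a₁ a₂ b₁ b₂ : K) (hs : s ^ 2 = -d) (hd : d ≠ 0) (hc : c = 1 / (2 * s))
    (ha₁ : a₁ = c * (1 + s)) (ha₂ : a₂ = c * (-1 + s)) (hb₁ : b₁ = c * (-1 + s)) (hb₂ : b₂ = c * (1 + s)) :
    c * c = -1 / (4 * d) ∧
    a₁ * b₁ = (d + 1) / (4 * d) ∧ a₂ * b₂ = (d + 1) / (4 * d) ∧
    a₁ * b₂ = (d - 1) / (4 * d) - s / (2 * d) ∧ a₂ * b₁ = (d - 1) / (4 * d) + s / (2 * d) := by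
  have hs0 : s ≠ 0 := by
    rintro rfl
    apply hd
    have : (0 : K) ^ 2 = -d := hs
    simpa using this.symm
  have hd' : d = -s ^ 2 := by rw [hs, neg_neg]
  subst hd' hc ha₁ ha₂ hb₁ hb₂
  have hs2 : s ^ 2 ≠ 0 := pow_ne_zero 2 hs0
  refine ⟨?_, ?_, ?_, ?_, ?_⟩ <;> field_simp <;> ring

/-- **[M] v2 p. 56 L73–74 and L82–83, the two non-vanishings the proof invokes**: «The rank of `Φ(F₁ ⊠ F₁)` is
non-zero, by Proposition 6.4.1(2), since the coefficient of `[λ₂⊠λ₁−λ₁⊠λ₂]` is non-zero.» and «… since the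
coefficient of `λ₁⊠λ₁+λ₂⊠λ₂` is non zero»: for a positive integer `d` and `s² = −d` (in a field of characteristic
`0`), `s/2d ≠ 0` and `(d+1)/4d ≠ 0` (while the middle coefficient `(d−1)/4d` vanishes exactly at `d = 1`).
Proposition 6.4.1 (2) itself (`n = 3` odd: the `∧`-part has weight `0`, i.e. carries the rank) is NOT formalised.
[cite: Markman2025SecantWeil, proof of Lemma 8.3.1, v2 p. 56 L73–74 and L82–83] -/
theorem lemma_8_3_1_nonvanishing (d : ℕ) (hd : 0 < d) (s : K) (hs : s ^ 2 = -(d : K)) :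
    s / (2 * (d : K)) ≠ 0 ∧ ((d : K) + 1) / (4 * (d : K)) ≠ 0 ∧
    (((d : K) - 1) / (4 * (d : K)) = 0 ↔ d = 1) := by
  have hdK : (d : K) ≠ 0 := by exact_mod_cast hd.ne'
  have hs0 : s ≠ 0 := by
    rintro rfl
    apply hdK
    have : (0 : K) ^ 2 = -(d : K) := hs
    simpa using this.symm
  refine ⟨?_, ?_, ?_⟩
  · exact div_ne_zero hs0 (mul_ne_zero two_ne_zero hdK)
  · refine div_ne_zero ?_ (mul_ne_zero (by norm_num) hdK)
    exact_mod_cast (Nat.succ_ne_zero d)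
  · rw [div_eq_zero_iff, sub_eq_zero]
    constructor
    · rintro (h | h)
      · exact_mod_cast h
      · exact absurd h (mul_ne_zero (by norm_num) hdK)
    · intro h; left; exact_mod_cast h

end SecantSquared

/-! ## (B) Proposition 9.2.2: the rank `8d`, as printed on p. 78, and the HRR cross-check -/

namespace Theta3

variable {K : Type*} [Field K] [CharZero K]

omit [CharZero K] in
/-- **[M] v2 p. 78 L34** «`H^i(O_X(2Θ) ⊗ L′)` vanishes, for `i > 0`, and `H⁰(O_X(2Θ) ⊗ L′)` is 8-dimensional»:
in the model `∫_X exp(2Θ) = (2Θ)³/3! = 8` (`= χ(O_X(2Θ) ⊗ L′)` by HRR with `td(X) = 1`, `L′` algebraically trivial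
— by value; with the printed vanishing this is `h⁰`). [cite: Markman2025SecantWeil, §9.2, proof of
Proposition 9.2.2, v2 p. 78 L34] -/
theorem integral_exp_two : integral (exp (2 : K)) = 8 := by
  simp [integral]; norm_num

/-- **[M] v2 p. 78 L49–50** «The restriction of `O_X(2Θ) ⊗ L′` to each of `C_i` and `Σ′_j` has degree `6`»: with
`[C_i] = Θ²/2` ([S] v2 p. 18 L14–15) the degree is `∫_X 2Θ · Θ²/2 = Θ³ = 6` (and `Θ · [C_i] = 3 = g`; `L′` has
degree `0` on the curves — by value). [cite: Markman2025SecantWeil, §9.2, proof of Proposition 9.2.2, v2 p. 78 L49–50]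
[cite: Markman2025SurveySecant, §11.1, v2 p. 18 L14–15] -/
theorem degree_twoTheta_on_AJ_curve :
    integral ((theta : Theta3 K) * ((1 / 2 : K) • thetaSq)) = 3 ∧
    integral (((2 : K) • (theta : Theta3 K)) * ((1 / 2 : K) • thetaSq)) = 6 := by
  constructor <;> simp [integral]
  all_goals norm_num

/-- **HRR cross-check of the same number** (not the printed route; `χ(X, F ⊗ G) = ∫_X ch(F)·ch(G)` on an abelian
threefold, `td(X) = 1`, and `ch(τ_x^*F₂ ⊗ L^{−1}) = ch(F₂) = ch(F₁) = α + β` by (9.2.1) «Note that `ch(F₁) = ch(F₂)`»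
and translation/`Pic⁰`-invariance of `ch` — by value): `∫_X (α + β)² = −8d`, with `∫α² = ∫β² = 0` and
`2∫αβ = −8d` (`∫αβ = −4d` is §8.3's `(α, β)_S`). So `χ(F₁ ⊗ τ_x^*F₂ ⊗ L^{−1}) = −8d` and, where only `H¹` survives,
`h¹ = 8d`. [cite: Markman2025SecantWeil, (9.2.1), v2 p. 72 L55–61]
[cite: Markman2025SecantWeil, §8.3, v2 p. 56 L20–24] -/
theorem integral_secantClass_sq (d : K) :
    integral (alpha d * alpha d) = 0 ∧ integral (beta d * beta d) = 0 ∧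
    2 * integral (alpha d * beta d) = -8 * d ∧
    integral ((alpha d + beta d) * (alpha d + beta d)) = -8 * d := by
  refine ⟨?_, ?_, ?_, ?_⟩ <;> simp [alpha, beta, integral] <;> ring

end Theta3

namespace SecantSquared

/-- **[M] v2 p. 78 L35–51** «We have `χ(O_{Z_x}(2Θ) ⊗ L′) = 8(d + 1)`. … `Z_x` is the disjoint union of these
`2d + 2` curves … degree `6` and thus Euler characteristic `4`. Hence, `χ(O_Z(2Θ) ⊗ L′) = 8(d + 1)` as claimed.»:
Riemann–Roch on a smooth genus-3 curve BY VALUE (`χ = deg + 1 − g = 6 + 1 − 3 = 4`), `d + 1` curves `C_i` and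
`d + 1` curves `Σ′_j`, additivity of `χ` over the disjoint union.
[cite: Markman2025SecantWeil, §9.2, proof of Proposition 9.2.2, v2 p. 78 L35–51] -/
theorem chi_OZ_twoTheta (d : ℤ) :
    (6 : ℤ) + 1 - 3 = 4 ∧ (d + 1) + (d + 1) = 2 * d + 2 ∧ (2 * d + 2) * ((6 : ℤ) + 1 - 3) = 8 * (d + 1) := by
  refine ⟨by norm_num, by ring, by ring⟩

/-- **[M] v2 (9.2.9) with p. 78 L3–5 and p. 77 L73–75**: from
`0 → F₁ ⊗ τ_x^*(F₂) ⊗ L^{−1} → O_X(2Θ) ⊗ L′ → O_{Z_x}(2Θ) ⊗ L′ → 0`,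
`χ(F₁ ⊗ τ_x^*F₂ ⊗ L^{−1}) = χ(O_X(2Θ) ⊗ L′) − χ(O_{Z_x}(2Θ) ⊗ L′) = 8 − 8(d+1) = −8d`; where (i) holds
(`H^i = 0` for `i ≠ 1`, i.e. off `Θ̃`) the only surviving group has `h¹ = 8d` — «the rank `8d` of the kernel of
`d₁`» = rank `G₁` = rank `E` (Proposition 9.2.2; [S] Prop. 11.1 (2) «rank `8q`»). The Euler characteristics and the
vanishing are inputs by value; the kernel checks the bookkeeping.
[cite: Markman2025SecantWeil, §9.2, proof of Proposition 9.2.2, v2 p. 77 L70–78, p. 78 L3–5 and L30–51]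
[cite: Markman2025SurveySecant, Proposition 11.1 (2), v2 p. 18 L48] -/
theorem rank_eq_eight_d (d h0 h1 h2 h3 χX χZ : ℤ) (hX : χX = 8) (hZ : χZ = 8 * (d + 1))
    (hses : h0 - h1 + h2 - h3 = χX - χZ) (hvan : h0 = 0 ∧ h2 = 0 ∧ h3 = 0) :
    χX - χZ = -8 * d ∧ h1 = 8 * d := by
  obtain ⟨r0, r2, r3⟩ := hvan
  subst hX hZ r0 r2 r3
  constructor <;> linarith

/-- The two routes to the fibre Euler characteristic agree: the printed `8 − 8(d+1)` ((9.2.9)) and the HRR value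
`∫_X(α+β)² = −8d` (`Theta3.integral_secantClass_sq`) are the same integer `−8d` for every `d`.
[cite: Markman2025SecantWeil, §9.2, proof of Proposition 9.2.2, v2 p. 78 L34–51] -/
theorem two_routes_agree (d : ℤ) : (8 : ℤ) - 8 * (d + 1) = -8 * d := by ring

/-- **[M] v2 p. 69 L5–7 / p. 73 L3–12** «`E` is locally free away from `(d+1)²` smooth surfaces in `X × X̂`» — the
surfaces `Θ̃_{i,j}`, `1 ≤ i, j ≤ d + 1` (pairwise disjoint under Assumption 9.2.1 (2): «The `(d + 1)²` points
`t_j + s_i`, `1 ≤ i, j ≤ d + 1`, are distinct»): the index set has `(d+1)²` elements.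
[cite: Markman2025SecantWeil, §9 opening, v2 p. 69 L5–7; Assumption 9.2.1 (2), p. 73 L3] -/
theorem surfaces_count (d : ℕ) : Fintype.card (Fin (d + 1) × Fin (d + 1)) = (d + 1) ^ 2 := by
  simp [sq]

end SecantSquared

end Literature.AlgebraicGeometry.Markman2025
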